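import Mathlib
import Summits.AtomisticToContinuum.FouriersLaw.Theses.JunctionLocality

/-!
# Sketch (crux-ideate round 1, ideator k = 2) for crux `SuperadditiveResistance`
(stmt-AtomisticToContinuum-11748, route JunctionLocality / ParityLiouvilleSeed).

First lemmas of the two idea cards filed from this seat:

* card `floating-probe-bypass-laplacian` — `generatorWithProbes` (the four-terminal device: the
  `(N+M)`-chain with its junction bond KEPT and an extra Langevin pair of friction `γ'` at the
  junction sites), and the arithmetic reduction `drop_one_le` (Schur-complement algebra of a
  floating merged probe pair: the "bond benefit" `R_N + R_M − R_dev` is bounded by two contact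
  corrections plus the BYPASS term `g_LR · (1/g_Lm + 1/g_mR)²`).
* card `balanced-split-concavity-transfer` — `superadditive_of_balanced` (pure arithmetic:
  balanced-split superadditivity + balanced-maximality ⇒ the crux's all-splits superadditivity).
-/

namespace Summit.AtomisticToContinuum.FouriersLaw.Cruxes.SuperadditiveResistance.IdeatorK2

open Literature.MathematicalPhysics.KineticTheory.HeatConduction

/-! ## Card A: the four-terminal device -/

/-- The generator of the `N`-site chain `P` between its two end baths (temperatures `T_L, T_R`,
friction `P.γ`, exactly `OscillatorChain.generator`) with an ADDITIONAL pair of Langevin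
thermostats of friction `γ'` and temperatures `Ta, Tb` acting on the momenta of two interior
sites `a, b` (the junction sites `N₀ - 1, N₀` of a split `N = N₀ + M₀`); the junction bond is kept.
`γ' = 0` is the bare chain; `γ' = P.γ` with the bond removed would be the cut system. -/
noncomputable def generatorWithProbes (P : OscillatorChain) (N : ℕ) (T_L T_R : ℝ)
    (a b : Fin N) (γ' Ta Tb : ℝ) (f : PhaseSpace N → ℝ) (x : PhaseSpace N) : ℝ :=
  P.generator N T_L T_R f x +
    γ' * ((Ta * partialP a (partialP a f) x - x.2 a * partialP a f x) +
          (Tb * partialP b (partialP b f) x - x.2 b * partialP b f x))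

/-- Weak steady states of the four-terminal device (same weak Fokker–Planck class as
`OscillatorChain.IsSteadyState`, with the device generator). -/
def IsDeviceSteadyState (P : OscillatorChain) (N : ℕ) (T_L T_R : ℝ) (a b : Fin N)
    (γ' Ta Tb : ℝ) (μ : MeasureTheory.Measure (PhaseSpace N)) : Prop :=
  MeasureTheory.IsProbabilityMeasure μ ∧
    (∀ f : PhaseSpace N → ℝ, ContDiff ℝ (⊤ : ℕ∞) f → HasCompactSupport f →
      ∫ x, generatorWithProbes P N T_L T_R a b γ' Ta Tb f x ∂μ = 0) ∧
    ∀ i : Fin N, MeasureTheory.Integrable (P.bondCurrent N i) μ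

/-- At `γ' = 0` the device generator is the bare chain's generator. -/
theorem generatorWithProbes_zero (P : OscillatorChain) (N : ℕ) (T_L T_R : ℝ) (a b : Fin N)
    (Ta Tb : ℝ) : generatorWithProbes P N T_L T_R a b 0 Ta Tb = P.generator N T_L T_R := by
  funext f x
  simp [generatorWithProbes]

/-- **Arithmetic core of card A (Schur complement of a floating merged probe pair).**
`GN, GM` : conductances of the two severed chains; `gLm, gmR` : device conductances from the outer
baths into the merged floating pair; `gLR` : the BYPASS conductance (outer bath to outer bath past
the thermostatted pair). If each contact correction is `≤ C₁` and the bypass satisfies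
`gLR (1/gLm + 1/gmR)² ≤ C₃`, then the bond benefit
`drop₁ = (1/GN + 1/GM) − 1/(gLR + gLm·gmR/(gLm+gmR))` is at most `2 C₁ + C₃`. -/
theorem drop_one_le {GN GM gLm gmR gLR C₁ C₃ : ℝ} (hGN : 0 < GN) (hGM : 0 < GM)
    (hLm : 0 < gLm) (hmR : 0 < gmR) (hLR : 0 ≤ gLR)
    (h₁ : 1 / GN - 1 / gLm ≤ C₁) (h₂ : 1 / GM - 1 / gmR ≤ C₁)
    (h₃ : gLR * (1 / gLm + 1 / gmR) ^ 2 ≤ C₃) :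
    (1 / GN + 1 / GM) - 1 / (gLR + gLm * gmR / (gLm + gmR)) ≤ 2 * C₁ + C₃ := by
  -- H := harmonic composition; 1/H = 1/gLm + 1/gmR; 1/H - 1/(H + gLR) = gLR/(H (H+gLR)) ≤ gLR/H²
  have hH : 0 < gLm * gmR / (gLm + gmR) := by positivity
  set H := gLm * gmR / (gLm + gmR) with hHdef
  have hinvH : 1 / H = 1 / gLm + 1 / gmR := by
    rw [hHdef]; field_simp; ring
  have hkey : 1 / H - 1 / (gLR + H) ≤ gLR * (1 / H) ^ 2 := by
    have hHg : 0 < gLR + H := by linarith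
    rw [div_sub_div _ _ (ne_of_gt hH) (ne_of_gt hHg)]
    rw [show gLR * (1 / H) ^ 2 = gLR / (H * H) by field_simp]
    rw [div_le_div_iff₀ (by positivity) (by positivity)]
    nlinarith [mul_nonneg hLR (le_of_lt hH), mul_nonneg (mul_nonneg hLR (le_of_lt hH)) hLR]
  have : (1 / GN + 1 / GM) - 1 / (gLR + H)
      = (1 / GN - 1 / gLm) + (1 / GM - 1 / gmR) + (1 / H - 1 / (gLR + H)) := by
    rw [hinvH]; ring
  rw [this]
  have h₃' : gLR * (1 / H) ^ 2 ≤ C₃ := by rw [hinvH]; exact h₃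
  linarith

/-! ## Card B: balanced splits + balanced maximality ⇒ all splits -/

/-- **Transfer lemma of card B.** For any real sequence `R` (think `R L = (L-1)/D_L`, the
end-to-end resistance): balanced-split superadditivity (`hbal`, the doubling / near-doubling
defect is bounded — the statistic the standing Disproof isolates) together with BALANCED
MAXIMALITY (`hmax`: among the splits of a fixed total length the balanced one has the largest
`R M + R (L - M)`, up to `C₂` — implied by almost-nonincreasing increments, i.e. approximate
concavity of `L ↦ R L`) gives the crux's superadditivity for ALL splits with constant `C₁ + C₂`. -/
theorem superadditive_of_balanced (R : ℕ → ℝ) (C₁ C₂ : ℝ)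
    (hbal : ∀ L : ℕ, 4 ≤ L → R (L / 2) + R (L - L / 2) - C₁ ≤ R L)
    (hmax : ∀ L M : ℕ, 2 ≤ M → 2 * M ≤ L → R M + R (L - M) ≤ R (L / 2) + R (L - L / 2) + C₂) :
    ∀ N M : ℕ, 2 ≤ N → 2 ≤ M → R N + R M - (C₁ + C₂) ≤ R (N + M) := by
  -- symmetric in (N, M): reduce to M ≤ N
  suffices key : ∀ N M : ℕ, 2 ≤ N → 2 ≤ M → M ≤ N → R N + R M - (C₁ + C₂) ≤ R (N + M) by
    intro N M hN hM
    rcases le_total M N with h | h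
    · exact key N M hN hM h
    · have := key M N hM hN h
      rw [Nat.add_comm] at this
      linarith
  intro N M hN hM hMN
  have hL : 4 ≤ N + M := by omega
  have h2M : 2 * M ≤ N + M := by omega
  have hsub : N + M - M = N := by omega
  have h1 := hmax (N + M) M hM h2M
  rw [hsub] at h1
  have h2 := hbal (N + M) hL
  linarith

/-- The crux decl is in scope (the cards' assembly target, by name). -/
example : Prop := Summit.AtomisticToContinuum.FouriersLaw.Theses.JunctionLocality.SuperadditiveResistance

end Summit.AtomisticToContinuum.FouriersLaw.Cruxes.SuperadditiveResistance.IdeatorK2
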